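import Literature.Probability.Distributions.GaussianHypercontractivity
import Literature.Computability.AlgebraicComplexity.AndrewsForbes2022Thm38Proofs
import Mathlib.Probability.Distributions.Gaussian.Multivariate
import Mathlib.Analysis.CStarAlgebra.Matrix
import Mathlib.Topology.Algebra.MvPolynomial

/-!
# Gaussian hypercontractivity for a finite product of multivariate Gaussians `⊗_{c ∈ κ} N(0, S)` — the shape of `gaussD H D = ⊗_{colours} boxDirichlet H`
# (toward E(5)/E(5a) of STUB-PLAN-E for stub E `stub_tiltMoments` of LINE-17, crux `BoxMidWindowsSU22`, stmt-QuantumFields-24003)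

The line's Gaussian `gaussD H D = Measure.pi (fun _ : Fin D => boxDirichlet H)` (`ColdBoxAllGroupsOneScaleDefs`) is a finite product of copies of the
centred multivariate Gaussian `boxDirichlet H = LatticeMaxwell.τ … = multivariateGaussian 0 Q_D⁻¹`.  This file extends `multivariateGaussian_bonami`
(sibling file) to such products: for any real matrix `S` on a finite index type `ι`, any finite `κ`, any `P : MvPolynomial (κ × ι) ℝ` of total degree
`≤ d` (a polynomial in ALL the coordinates `(c, i) ↦ (t c)_i`) and `r ≥ 1`,

  `∫ (eval (fun v => (t v.1) v.2) P)^{2r} d(⊗_κ N(0,S)) ≤ (2r−1)^{rd} · (∫ (eval … P)² d(⊗_κ N(0,S)))^r`   (`pi_multivariateGaussian_bonami`).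

Steps: `⊗_{c} ⊗_{i} γ = (⊗_{(c,i)} γ).map uncurry` (`pi_pi_eq_map_uncurry`, by uniqueness of product measures `Measure.pi_eq`); hence
`⊗_κ N(0,S)` is the image of `⊗_{κ×ι} N(0,1)` under the block-linear map `w ↦ (c ↦ √S · w(c, ·))` (`pi_multivariateGaussian_eq_map`); the pulled-back
integrand is the evaluation of the block-linear substitution `bind₁ ℓ P`, `ℓ (c,i) = Σ_j C (√S)_{ij} X_{(c,j)}` (degree not raised); then the tree's
`gaussian_bonami_pi'` on the index type `κ × ι`.  Pure Mathlib + tree; no definition.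
HONEST LABEL: helper for an open registered stub of a critic-passed line on the R2ξ″ RECORD-rung crux 24003; no stub is proved by name, no crux, rung
or summit is proved; the Yang–Mills mass gap is NOT proved by this.
-/

set_option autoImplicit false

noncomputable section

open MeasureTheory ProbabilityTheory Finset MvPolynomial
open scoped Matrix MatrixOrder

namespace Summit.QuantumFields.YangMills.Theorems.AllWindowsColdBox.GaussHypercontractivity

/-! ## A product of product measures is a product measure -/

/-- **`⊗_c ⊗_i μ_{c,i} = (⊗_{(c,i)} μ_{c,i}).map curry`**, stated as: the product measure over `κ × ι` is the image of the iterated product under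
`f ↦ ((c,i) ↦ f c i)`; by uniqueness of finite product measures on rectangles. -/
theorem pi_prod_eq_map_pi_pi {κ ι X : Type*} [Fintype κ] [Fintype ι] [MeasurableSpace X]
    (μ : κ → ι → Measure X) [∀ c i, SigmaFinite (μ c i)] :
    Measure.pi (fun v : κ × ι => μ v.1 v.2) =
      (Measure.pi fun c : κ => Measure.pi fun i : ι => μ c i).map (fun f : κ → ι → X => fun v : κ × ι => f v.1 v.2) := by
  have hU : Measurable fun f : κ → ι → X => fun v : κ × ι => f v.1 v.2 :=
    measurable_pi_lambda _ fun v => (measurable_pi_apply v.2).comp (measurable_pi_apply v.1)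
  refine Measure.pi_eq fun t ht => ?_
  rw [Measure.map_apply hU (MeasurableSet.univ_pi ht)]
  have hpre : (fun f : κ → ι → X => fun v : κ × ι => f v.1 v.2) ⁻¹' Set.univ.pi t =
      Set.univ.pi fun c : κ => Set.univ.pi fun i : ι => t (c, i) := by
    ext f
    simp only [Set.mem_preimage, Set.mem_univ_pi, Prod.forall]
  rw [hpre, Measure.pi_pi]
  simp_rw [Measure.pi_pi]
  rw [Fintype.prod_prod_type]

/-! ## `⊗_κ N(0,S)` as a block-linear image of the product standard Gaussian -/

variable {ι κ : Type*} [Fintype ι] [DecidableEq ι] [Fintype κ] [DecidableEq κ]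

omit [DecidableEq κ] in
/-- `⊗_{c ∈ κ} N(0,S)` is the image of `⊗_{(c,i) ∈ κ×ι} N(0,1)` under `w ↦ (c ↦ √S · w(c, ·))`. -/
theorem pi_multivariateGaussian_eq_map (S : Matrix ι ι ℝ) :
    (Measure.pi fun _ : κ => multivariateGaussian (0 : EuclideanSpace ℝ ι) S) =
      (Measure.pi fun _ : κ × ι => gaussianReal 0 1).map
        (fun w : κ × ι → ℝ => fun c : κ => (WithLp.toLp 2 (CFC.sqrt S *ᵥ fun i => w (c, i)) : EuclideanSpace ℝ ι)) := by
  have hL : Measurable fun z : ι → ℝ => (WithLp.toLp 2 (CFC.sqrt S *ᵥ z) : EuclideanSpace ℝ ι) :=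
    (WithLp.measurable_toLp 2 _).comp (continuous_const.matrix_mulVec continuous_id).measurable
  have hmap : multivariateGaussian (0 : EuclideanSpace ℝ ι) S =
      (Measure.pi fun _ : ι => gaussianReal 0 1).map
        (fun z : ι → ℝ => (WithLp.toLp 2 (CFC.sqrt S *ᵥ z) : EuclideanSpace ℝ ι)) := by
    rw [multivariateGaussian, ← map_pi_eq_stdGaussian, Measure.map_map (by fun_prop) (WithLp.measurable_toLp 2 _)]
    congr 1
    funext z
    simp [Matrix.toEuclideanCLM_toLp]
  have hU : Measurable fun f : κ → ι → ℝ => fun v : κ × ι => f v.1 v.2 :=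
    measurable_pi_lambda _ fun v => (measurable_pi_apply v.2).comp (measurable_pi_apply v.1)
  have hG : Measurable fun w : κ × ι → ℝ => fun c : κ =>
      (WithLp.toLp 2 (CFC.sqrt S *ᵥ fun i => w (c, i)) : EuclideanSpace ℝ ι) :=
    measurable_pi_lambda _ fun c => hL.comp (measurable_pi_lambda _ fun i => measurable_pi_apply (c, i))
  rw [hmap, ← Measure.pi_map_pi fun _ => hL.aemeasurable,
    pi_prod_eq_map_pi_pi (fun (_ : κ) (_ : ι) => gaussianReal 0 1), Measure.map_map hG hU]
  rfl

omit [DecidableEq ι] [Fintype κ] [DecidableEq κ] in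
/-- The block-linear substitution evaluates to the block map: `eval w (bind₁ ℓ P) = eval ((c,i) ↦ (√S w(c,·))_i) P`. -/
theorem eval_bind₁_blockLinear (A : Matrix ι ι ℝ) (P : MvPolynomial (κ × ι) ℝ) (w : κ × ι → ℝ) :
    eval w (bind₁ (fun v : κ × ι => ∑ j, C (A v.2 j) * X (v.1, j)) P) =
      eval (fun v : κ × ι => (A *ᵥ fun i => w (v.1, i)) v.2) P := by
  have hl : ∀ v : κ × ι, eval w (∑ j, C (A v.2 j) * X (v.1, j) : MvPolynomial (κ × ι) ℝ) =
      (A *ᵥ fun i => w (v.1, i)) v.2 := fun v => by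
    simp [Matrix.mulVec, dotProduct]
  show eval₂Hom (RingHom.id ℝ) w (bind₁ (fun v : κ × ι => ∑ j, C (A v.2 j) * X (v.1, j)) P) = _
  rw [eval₂Hom_bind₁]
  show eval (fun v => eval w (∑ j, C (A v.2 j) * X (v.1, j) : MvPolynomial (κ × ι) ℝ)) P = _
  simp_rw [hl]

omit [DecidableEq ι] [Fintype κ] [DecidableEq κ] in
/-- The block-linear substitution does not raise the total degree. -/
theorem totalDegree_bind₁_blockLinear_le (A : Matrix ι ι ℝ) (P : MvPolynomial (κ × ι) ℝ) :
    (bind₁ (fun v : κ × ι => ∑ j, C (A v.2 j) * X (v.1, j)) P).totalDegree ≤ P.totalDegree := by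
  refine Literature.Computability.AlgebraicComplexity.Theorem38.totalDegree_bind₁_le_of_le_one _ (fun v => ?_) P
  refine (totalDegree_finsetSum _ _).trans (Finset.sup_le fun j _ => ?_)
  refine (totalDegree_mul _ _).trans ?_
  rw [totalDegree_C, zero_add]
  exact (totalDegree_X (R := ℝ) _).le

omit [DecidableEq κ] in
/-- Transport of polynomial moments to the product standard Gaussian on `κ × ι`. -/
theorem integral_eval_pow_pi_multivariateGaussian (S : Matrix ι ι ℝ) (P : MvPolynomial (κ × ι) ℝ) (q : ℕ) :
    ∫ t, (eval (fun v : κ × ι => WithLp.ofLp (t v.1) v.2) P) ^ q ∂(Measure.pi fun _ : κ => multivariateGaussian (0 : EuclideanSpace ℝ ι) S) =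
      ∫ w, (eval w (bind₁ (fun v : κ × ι => ∑ j, C (CFC.sqrt S v.2 j) * X (v.1, j)) P)) ^ q
        ∂(Measure.pi fun _ : κ × ι => gaussianReal 0 1) := by
  have hL : Measurable fun z : ι → ℝ => (WithLp.toLp 2 (CFC.sqrt S *ᵥ z) : EuclideanSpace ℝ ι) :=
    (WithLp.measurable_toLp 2 _).comp (continuous_const.matrix_mulVec continuous_id).measurable
  have hmeas : Measurable fun w : κ × ι → ℝ => fun c : κ =>
      (WithLp.toLp 2 (CFC.sqrt S *ᵥ fun i => w (c, i)) : EuclideanSpace ℝ ι) :=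
    measurable_pi_lambda _ fun c => hL.comp (measurable_pi_lambda _ fun i => measurable_pi_apply (c, i))
  have hcont : Continuous fun t : κ → EuclideanSpace ℝ ι => (eval (fun v : κ × ι => WithLp.ofLp (t v.1) v.2) P) ^ q := by
    refine ((MvPolynomial.continuous_eval P).comp ?_).pow q
    exact continuous_pi fun v => ((PiLp.continuous_apply 2 (fun _ : ι => ℝ) v.2).comp (continuous_apply v.1))
  rw [pi_multivariateGaussian_eq_map S, integral_map hmeas.aemeasurable hcont.aestronglyMeasurable]
  refine integral_congr_ae (ae_of_all _ fun w => ?_)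
  simp only [eval_bind₁_blockLinear]

/-- **Hypercontractivity for `⊗_κ N(0, S)`**: for every real matrix `S`, finite `κ`, every `P : MvPolynomial (κ × ι) ℝ` of total degree `≤ d` and
`r ≥ 1`, `∫ (eval ((c,i) ↦ (t c)_i) P)^{2r} d(⊗_κ N(0,S)) ≤ (2r−1)^{rd} (∫ (eval … P)² d(⊗_κ N(0,S)))^r`. -/
theorem pi_multivariateGaussian_bonami (S : Matrix ι ι ℝ) (d : ℕ) (P : MvPolynomial (κ × ι) ℝ) (hP : P.totalDegree ≤ d)
    (r : ℕ) (hr : 1 ≤ r) :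
    ∫ t, (eval (fun v : κ × ι => WithLp.ofLp (t v.1) v.2) P) ^ (2 * r)
        ∂(Measure.pi fun _ : κ => multivariateGaussian (0 : EuclideanSpace ℝ ι) S) ≤
      (2 * r - 1 : ℝ) ^ (r * d) *
        (∫ t, (eval (fun v : κ × ι => WithLp.ofLp (t v.1) v.2) P) ^ 2
          ∂(Measure.pi fun _ : κ => multivariateGaussian (0 : EuclideanSpace ℝ ι) S)) ^ r := by
  rw [integral_eval_pow_pi_multivariateGaussian S P (2 * r), integral_eval_pow_pi_multivariateGaussian S P 2]
  exact Literature.Probability.Distributions.gaussian_bonami_pi' d _ ((totalDegree_bind₁_blockLinear_le _ P).trans hP) r hr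

end Summit.QuantumFields.YangMills.Theorems.AllWindowsColdBox.GaussHypercontractivity

end
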